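import Literature.AlgebraicGeometry.Resolution.HenselianRationalityPerfect
import Literature.AlgebraicGeometry.Resolution.RelativeCurveValuativeInputCharP
import Literature.AlgebraicGeometry.Resolution.RelativeCurveValuativeInputCharZero
import Literature.AlgebraicGeometry.Resolution.RelativeCurveSmoothFibreAssembly
import Literature.AlgebraicGeometry.Resolution.InseparableLocalUniformizationRelativeOneLeaf
import HarnessLib

/-!
# Temkin's Thm. 3.3.1 (smooth-fibre case) and Thm. 1.3.2 from the algebraization (J2) alone

Topic: `Literature/AlgebraicGeometry/Resolution`. M. Temkin, *Inseparable local uniformization*,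
J. Algebra 373 (2013) = arXiv:0804.1554v3. The named fact `Temkin2013RelativeCurveSmoothFibre`
(Thm. 3.3.1, `n = 1`, smooth generic fibres) is reduced in the tree to its valuative input (J1)
and its algebraization (J2) (`Temkin2013RelativeCurveSmoothFibre.of_inputs`,
`RelativeCurveSmoothFibreAssembly.lean`), and (J1) to the henselian-rationality statement (HR)
(`RelativeCurveValuativeInputCharP.lean`, `RelativeCurveSmoothFibreFromHR.lean`). With (HR) PROVED (`henselianRational_of_perfect`,
`HenselianRationalityPerfect.lean`: Temkin's Thm. 3.2.3 in henselian form — the tame extension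
without tame extensions of `TameRootLayers.lean` for `L^{mr}`, [temst] =
`HenselianRationalityPerfectSplit.lean`, Kuhlmann–Vlahu's pull-down = `TameDescent.lean` for
[Duc]) this file records the specializations:

* `henselianRational_HR` — (HR) in the universally quantified form of the assembly files — PROVED;
* `valuativeInput_J1` — **(J1)**, the first hypothesis of
  `Temkin2013RelativeCurveSmoothFibre.of_inputs` — PROVED;
* `Temkin2013RelativeCurveSmoothFibre.of_algebraization` — **(J2) ⇒
  `Temkin2013RelativeCurveSmoothFibre`** — PROVED;
* `Temkin2013.of_algebraization` — **(J2) ⇒ `Temkin2013`** (Thm. 1.3.2, weak form; through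
  `Temkin2013.of_smoothFibre`, `InseparableLocalUniformizationRelativeOneLeaf.lean`) — PROVED.

So the trust base of `Temkin2013` is exactly the algebraization (J2) of the proof of Thm. 3.3.1
(Steps 2–4: the common smooth roof from the two étale charts), an explicit hypothesis here
(inline proposition, not a named fact; its construction is the `RelativeCurveChart`/`DChart*`/
`EChart`/`RoofInField` series). No definitions, no named facts.

## Sources

* M. Temkin, arXiv:0804.1554v3, Thm. 1.3.2, Thm. 3.2.3, Thm. 3.3.1 (proof, Steps 1–4).
  [Temkin2013]
-/

noncomputable section

open IsLocalRing

namespace Literature.AlgebraicGeometry.Resolution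

universe u

/-- **(HR), universally quantified** (as consumed by `valuativeInput_of_henselianRational` and
`Temkin2013RelativeCurveSmoothFibre.of_henselianRational`): henselian rationality over perfect
henselian split bases of rank one in characteristic `p`. [cite: Temkin2013, Thm. 3.2.3] -/
theorem henselianRational_HR :
    ∀ (Ω : Type u) [Field Ω] [IsAlgClosed Ω] (V : ValuationSubring Ω) (p : ℕ)
      [Fact p.Prime] [CharP Ω p] [CharP (ResidueField V) p] (C F : Subfield Ω),
      IsHenselianField C (V.comap (algebraMap C Ω)) →
      (∀ y ∈ C, ∃ b ∈ C, b ^ p = y) → IsRankOne V C → C ≤ F → FGOver C F →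
      SeparablyGeneratedOver C F →
      (∃ t ∈ F, Transcendental C t ∧
        ∀ z ∈ F, IsAlgebraic (IntermediateField.adjoin C ({t} : Set Ω)) z) →
      IsImmediateOver V C F → (∀ a ∈ henselization V F, IsAlgebraic C a → a ∈ C) →
      ∃ x ∈ F, Transcendental C x ∧ F ≤ henselization V (Subfield.closure ((C : Set Ω) ∪ {x})) :=
  fun _ _ _ V p _ _ _ C F hC hperf hr hCF hfg hsg h1 himm hrel =>
    henselianRational_of_perfect V p C F hC hperf hr hCF hfg hsg h1 himm hrel

/-- **(J1): the finite-level valuative datum of Thm. 3.3.1, in all (equal) characteristics** —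
the first hypothesis of `Temkin2013RelativeCurveSmoothFibre.of_inputs`, verbatim.
[cite: Temkin2013, Thm. 3.3.1 (proof, Step 2) with Thms. 3.2.3, 3.2.4, 3.2.6] -/
theorem valuativeInput_J1 :
    ∀ (Ω : Type u) [Field Ω] [IsAlgClosed Ω] (V : ValuationSubring Ω) (k K₁ : Subfield Ω),
      k ≤ K₁ → IsRankOneValued V k → ringExpChar (ResidueField V) = ringExpChar Ω →
      FGOver k K₁ → SeparablyGeneratedOver k K₁ →
      (∃ t ∈ K₁, Transcendental k t ∧
        ∀ z ∈ K₁, IsAlgebraic (IntermediateField.adjoin k ({t} : Set Ω)) z) →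
      IsValueTorsionOver V k K₁ → IsResiduallyAlgebraicOver V k K₁ →
      ∃ (S Y : Finset Ω) (t : Ω), (∀ s ∈ S, ∃ n : ℕ, s ^ (ringExpChar Ω) ^ n ∈ k) ∧
        (∀ y ∈ Y, IsSeparable (Subfield.closure ((k : Set Ω) ∪ ↑S)) y) ∧
        t ∈ K₁ ⊔ Subfield.closure ((k : Set Ω) ∪ ↑S) ∧ t ∈ V ∧ Transcendental k t ∧
        (↑Y : Set Ω) ⊆ henselization V (K₁ ⊔ Subfield.closure ((k : Set Ω) ∪ ↑S)) ∧
        K₁ ≤ henselization V (Subfield.closure ((k : Set Ω) ∪ ↑S ∪ ↑Y ∪ {t})) := by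
  intro Ω _ _ V k K₁ hkK₁ hr1 hchar hfg _hsg h1 hvt hra
  obtain ⟨p, hexp⟩ := ExpChar.exists Ω
  rcases hexp with _ | ⟨hp⟩
  · -- characteristic `0`
    haveI : ExpChar Ω 1 := ExpChar.zero
    have hq : ringExpChar Ω = 1 := ringExpChar.eq Ω 1
    exact valuativeInput_of_ringExpChar_eq_one V k K₁ hkK₁ hchar hq hfg h1 hvt hra
  · -- characteristic `p > 0` (`CharP Ω p` is in context)
    haveI : Fact p.Prime := ⟨hp⟩
    haveI : ExpChar Ω p := ExpChar.prime hp
    have hq : ringExpChar Ω = p := ringExpChar.eq Ω p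
    have hres : ExpChar (ResidueField V) p := ringExpChar.of_eq (hchar.trans hq)
    haveI : CharP (ResidueField V) p := by
      rcases hres with _ | ⟨hp'⟩
      · exact absurd hp Nat.not_prime_one
      · infer_instance
    exact valuativeInput_charP_of_henselianRational V p
      (fun C F hC hperf hr hCF hfg' hsg' h1' himm hrel =>
        henselianRational_of_perfect V p C F hC hperf hr hCF hfg' hsg' h1' himm hrel)
      k K₁ hkK₁ hr1 hfg h1 hvt hra

/-- **(J2) ⇒ `Temkin2013RelativeCurveSmoothFibre`**: Thm. 3.3.1 (smooth-fibre case) from its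
algebraization alone (verbatim as in `Temkin2013RelativeCurveSmoothFibre.of_inputs`).
[cite: Temkin2013, Thm. 3.3.1 (proof, Steps 1–4) with Thms. 3.2.3, 3.2.4, 3.2.6] -/
theorem Temkin2013RelativeCurveSmoothFibre.of_algebraization
    (hJ2 : ∀ (k K : Type u) [Field k] [Field K] [Algebra k K]
      (Ok : ValuationSubring k) (O : ValuationSubring K),
      ringChar (ResidueField Ok) = ringChar k →
      O.comap (algebraMap k K) = Ok → ringKrullDim Ok = 1 → ringKrullDim O = 1 →
      (⊤ : IntermediateField k K).FG → Algebra.trdeg k K = 1 →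
      IsValueTorsionOver O (algebraMap k K).fieldRange ⊤ →
      IsResiduallyAlgebraicOver O (algebraMap k K).fieldRange ⊤ →
      ∀ A : Subring K, IsAffineNormalizedModel O (Ok.toSubring.map (algebraMap k K)) A →
      Algebra.Smooth k (Algebra.adjoin k (A : Set K)) →
      ∀ (L₁ : Type u) [Field L₁] [Algebra K L₁] [Algebra k L₁] [IsScalarTower k K L₁],
      FiniteDimensional K L₁ →
      ∀ O₁ : ValuationSubring L₁, O₁.comap (algebraMap K L₁) = O →
      Algebra.Smooth k (Algebra.adjoin k (nrIn (A.map (algebraMap K L₁)) : Set L₁)) →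
      ∀ (Ω : Type u) [Field Ω] [IsAlgClosed Ω] [Algebra L₁ Ω] [Algebra K Ω] [Algebra k Ω]
        [IsScalarTower K L₁ Ω] [IsScalarTower k L₁ Ω] [IsScalarTower k K Ω]
        (V : ValuationSubring Ω), V.comap (algebraMap L₁ Ω) = O₁ →
      ∀ (Y : Finset Ω), (∀ y ∈ Y, IsSeparable k y) →
        (↑Y : Set Ω) ⊆ henselization V (algebraMap L₁ Ω).fieldRange →
      ∀ x : L₁, x ∈ O₁ → Transcendental k (algebraMap L₁ Ω x) →
        (algebraMap L₁ Ω).fieldRange ≤ henselization V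
          (Subfield.closure (Set.range (algebraMap k Ω) ∪ ↑Y ∪ {algebraMap L₁ Ω x})) →
      Temkin2013RelativeCurveConclusion k K Ok O A L₁ O₁) :
    Temkin2013RelativeCurveSmoothFibre.{u} :=
  Temkin2013RelativeCurveSmoothFibre.of_inputs valuativeInput_J1 hJ2

/-- **(J2) ⇒ `Temkin2013`** (Thm. 1.3.2, weak absolute form): the trust base of inseparable
local uniformization in the tree is the algebraization (J2) of the proof of Thm. 3.3.1.
[cite: Temkin2013, Thm. 1.3.2 with Thm. 3.3.1] -/
theorem Temkin2013.of_algebraization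
    (hJ2 : ∀ (k K : Type u) [Field k] [Field K] [Algebra k K]
      (Ok : ValuationSubring k) (O : ValuationSubring K),
      ringChar (ResidueField Ok) = ringChar k →
      O.comap (algebraMap k K) = Ok → ringKrullDim Ok = 1 → ringKrullDim O = 1 →
      (⊤ : IntermediateField k K).FG → Algebra.trdeg k K = 1 →
      IsValueTorsionOver O (algebraMap k K).fieldRange ⊤ →
      IsResiduallyAlgebraicOver O (algebraMap k K).fieldRange ⊤ →
      ∀ A : Subring K, IsAffineNormalizedModel O (Ok.toSubring.map (algebraMap k K)) A →
      Algebra.Smooth k (Algebra.adjoin k (A : Set K)) →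
      ∀ (L₁ : Type u) [Field L₁] [Algebra K L₁] [Algebra k L₁] [IsScalarTower k K L₁],
      FiniteDimensional K L₁ →
      ∀ O₁ : ValuationSubring L₁, O₁.comap (algebraMap K L₁) = O →
      Algebra.Smooth k (Algebra.adjoin k (nrIn (A.map (algebraMap K L₁)) : Set L₁)) →
      ∀ (Ω : Type u) [Field Ω] [IsAlgClosed Ω] [Algebra L₁ Ω] [Algebra K Ω] [Algebra k Ω]
        [IsScalarTower K L₁ Ω] [IsScalarTower k L₁ Ω] [IsScalarTower k K Ω]
        (V : ValuationSubring Ω), V.comap (algebraMap L₁ Ω) = O₁ →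
      ∀ (Y : Finset Ω), (∀ y ∈ Y, IsSeparable k y) →
        (↑Y : Set Ω) ⊆ henselization V (algebraMap L₁ Ω).fieldRange →
      ∀ x : L₁, x ∈ O₁ → Transcendental k (algebraMap L₁ Ω x) →
        (algebraMap L₁ Ω).fieldRange ≤ henselization V
          (Subfield.closure (Set.range (algebraMap k Ω) ∪ ↑Y ∪ {algebraMap L₁ Ω x})) →
      Temkin2013RelativeCurveConclusion k K Ok O A L₁ O₁) :
    Temkin2013.{u} :=
  Temkin2013.of_smoothFibre (Temkin2013RelativeCurveSmoothFibre.of_algebraization hJ2)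

end Literature.AlgebraicGeometry.Resolution

end
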